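import Literature.MathematicalPhysics.QuantumLattice.SusyTJBondIdentity
import Literature.MathematicalPhysics.QuantumLattice.NagaokaTasakiProofs

/-!
# Route `HyperoctahedralMott`, support `CompleteGraphAnchor` (item stmt-HubbardSuperconductivity-6677):
# CAR bookkeeping for the sum-of-squares (Casimir) identity

Helper file 1/4 for the complete-graph anchor. For a Gutzwiller vector `ψ` (no double occupancy)
the graded site swap `Sw x y = siteSwap x y` has, by the tree's supersymmetric bond identity
(`SusyTJ.gutzwiller_bond_identity`), the expectation
`⟨ψ, Sw ψ⟩ = ⟨ψ, T_{xy} ψ⟩ + ⟨ψ, B†B ψ⟩ - ⟨ψ, (n_x + n_y) ψ⟩ + ‖ψ‖²`.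
This file collects that consequence together with the elementary CAR / projector facts used to
resum the hopping `T` and the singlet-pair density `B†B` over all ordered pairs of the complete
graph: the zero-momentum anticommutator `{C_σ, C_σ†} = |Λ|`, the Gutzwiller projector sandwich,
`P c† P = (1 - n_{σ̄}) c† P` in vector form, the doublon part of `C_σ† ψ`, and the spin-flip
reordering `(c†_{y↑}c_{x↑})(c†_{x↓}c_{y↓}) = -S⁻_x S⁺_y`.
No definitions. Sources for the CAR: Bratteli–Robinson II §5.2.2; physics context: Sarkar,
J. Phys. A 24 (1991) 1137 (supersymmetric `t`-`J` model as graded permutations).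
-/

-- the mandated namespace `Summit.<Summit>.<Problem>.Theorems` repeats `HubbardSuperconductivity`
-- (single-problem summit, D-0017), which the `dupNamespace` linter flags on every declaration
set_option linter.dupNamespace false

noncomputable section

namespace Summit.HubbardSuperconductivity.HubbardSuperconductivity.Theorems.HyperoctahedralMott.Anchor

open Matrix Finset Literature.MathematicalPhysics.QuantumLattice HubbardWave0
open scoped ComplexOrder

/-! ### Generic inner-product bookkeeping -/

section General

variable {ι : Type*} [Fintype ι]

/-- `⟨A ψ, B φ⟩ = ⟨ψ, (Aᴴ B) φ⟩`. [folklore] -/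
theorem star_mulVec_dotProduct_mulVec (A B : Matrix ι ι ℂ) (ψ φ : ι → ℂ) :
    star (A *ᵥ ψ) ⬝ᵥ (B *ᵥ φ) = star ψ ⬝ᵥ ((Aᴴ * B) *ᵥ φ) := by
  rw [star_mulVec, ← dotProduct_mulVec, mulVec_mulVec]

/-- `⟨ψ, ψ⟩` is real: it equals the cast of its real part. [folklore] -/
theorem star_dotProduct_self_eq_re (ψ : ι → ℂ) :
    star ψ ⬝ᵥ ψ = (((star ψ ⬝ᵥ ψ).re : ℝ) : ℂ) := by
  rw [NagaokaTasaki.star_dotProduct_self_eq]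
  norm_cast

/-- `0 ≤ Re ⟨ψ, ψ⟩`. [folklore] -/
theorem star_dotProduct_self_re_nonneg (ψ : ι → ℂ) : 0 ≤ (star ψ ⬝ᵥ ψ).re := by
  rw [NagaokaTasaki.star_dotProduct_self_eq, Complex.ofReal_re]
  exact Finset.sum_nonneg fun i _ => Complex.normSq_nonneg _

variable [DecidableEq ι]

/-- Pythagoras for a self-adjoint idempotent `P`: `‖v‖² = ‖P v‖² + ‖(1 - P) v‖²`. [folklore] -/
theorem star_dotProduct_self_eq_add_of_proj {P : Matrix ι ι ℂ} (hP : Pᴴ = P) (hPP : P * P = P)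
    (v : ι → ℂ) :
    star v ⬝ᵥ v = star (P *ᵥ v) ⬝ᵥ (P *ᵥ v) + star ((1 - P) *ᵥ v) ⬝ᵥ ((1 - P) *ᵥ v) := by
  rw [star_mulVec_dotProduct_mulVec, star_mulVec_dotProduct_mulVec, hP, hPP,
    conjTranspose_sub, conjTranspose_one, hP]
  have h : ((1 : Matrix ι ι ℂ) - P) * (1 - P) = 1 - P := by
    rw [sub_mul, one_mul, mul_sub, mul_one, hPP, sub_self, sub_zero]
  rw [h, sub_mulVec, one_mulVec, dotProduct_sub, add_sub_cancel]

end General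

/-! ### The Gutzwiller projector -/

section Projector

variable {Λ : Type*} [LinearOrder Λ] [Fintype Λ]

/-- The Gutzwiller projector is self-adjoint. [folklore] -/
theorem gutzwillerProj_conjTranspose :
    (gutzwillerProj : Matrix (Finset (Orb Λ)) (Finset (Orb Λ)) ℂ)ᴴ = gutzwillerProj := by
  rw [gutzwillerProj, diagonal_conjTranspose]
  congr 1
  funext s
  rw [Pi.star_apply]
  split_ifs <;> simp

/-- The Gutzwiller projector is idempotent. [folklore] -/
theorem gutzwillerProj_mul_self :
    (gutzwillerProj : Matrix (Finset (Orb Λ)) (Finset (Orb Λ)) ℂ) * gutzwillerProj = gutzwillerProj := by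
  rw [gutzwillerProj, diagonal_mul_diagonal]
  congr 1
  funext s
  split_ifs <;> simp

/-- The projector sandwich is invisible inside a Gutzwiller expectation:
`⟨ψ, P X P ψ⟩ = ⟨ψ, X ψ⟩` when `P ψ = ψ`. [folklore] -/
theorem expect_sandwich {ψ : Fock (Orb Λ)} (hψ : gutzwillerProj *ᵥ ψ = ψ)
    (X : Matrix (Finset (Orb Λ)) (Finset (Orb Λ)) ℂ) :
    star ψ ⬝ᵥ ((gutzwillerProj * X * gutzwillerProj) *ᵥ ψ) = star ψ ⬝ᵥ (X *ᵥ ψ) := by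
  have h1 : (gutzwillerProj * X * gutzwillerProj) *ᵥ ψ = gutzwillerProj *ᵥ (X *ᵥ ψ) := by
    rw [← mulVec_mulVec, ← mulVec_mulVec, hψ]
  have h2 : star ψ ᵥ* (gutzwillerProj : Matrix (Finset (Orb Λ)) (Finset (Orb Λ)) ℂ) =
      star (gutzwillerProj *ᵥ ψ) := by
    rw [star_mulVec, gutzwillerProj_conjTranspose]
  rw [h1, dotProduct_mulVec, h2, hψ]

/-- A doublon operator kills a Gutzwiller vector: `n_{x↑} n_{x↓} ψ = 0`. [folklore] -/
theorem doublon_mulVec_eq_zero {ψ : Fock (Orb Λ)} (hψ : IsGutzwiller ψ) (x : Λ) :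
    (numberOp x 0 * numberOp x 1) *ᵥ ψ = 0 := by
  funext s
  rw [LiebTwo.numberOp_mul_numberOp_mulVec, Pi.zero_apply]
  split_ifs with h
  · exact hψ s ⟨x, h.1, h.2⟩
  · rfl

/-- On a Gutzwiller vector `n^s_x = n_{x↑} + n_{x↓} - 2 n_{x↑}n_{x↓}` acts as `n_{x↑} + n_{x↓}`.
[folklore] -/
theorem singleOcc_mulVec {ψ : Fock (Orb Λ)} (hψ : IsGutzwiller ψ) (x : Λ) :
    (numberOp x 0 + numberOp x 1 - (2 : ℂ) • (numberOp x 0 * numberOp x 1)) *ᵥ ψ =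
      (numberOp x 0 + numberOp x 1) *ᵥ ψ := by
  rw [sub_mulVec, smul_mulVec, doublon_mulVec_eq_zero hψ, smul_zero, sub_zero]

/-- **The swap expectation on the Gutzwiller space** (consequence of
`SusyTJ.gutzwiller_bond_identity`): for `x ≠ y` and a Gutzwiller vector `ψ`,
`⟨ψ, Sw ψ⟩ = ⟨ψ, T ψ⟩ + ⟨ψ, B†B ψ⟩ - ⟨ψ, (n_{x↑}+n_{x↓}) ψ⟩ - ⟨ψ, (n_{y↑}+n_{y↓}) ψ⟩ + ‖ψ‖²`.
[cite: Sarkar1991, eq. (2)–(4) (supersymmetric t-J model as graded permutations)] -/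
theorem expect_siteSwap {x y : Λ} (hxy : x ≠ y) {ψ : Fock (Orb Λ)} (hψ : IsGutzwiller ψ) :
    star ψ ⬝ᵥ (siteSwap x y *ᵥ ψ) =
      star ψ ⬝ᵥ ((∑ σ : Fin 2, (creation (orb x σ) * annihilation (orb y σ) +
          creation (orb y σ) * annihilation (orb x σ))) *ᵥ ψ) +
      star ψ ⬝ᵥ ((((annihilation (orb x 0) * annihilation (orb y 1) -
          annihilation (orb x 1) * annihilation (orb y 0))ᴴ *
        (annihilation (orb x 0) * annihilation (orb y 1) -
          annihilation (orb x 1) * annihilation (orb y 0))) *ᵥ ψ)) -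
      star ψ ⬝ᵥ ((numberOp x 0 + numberOp x 1) *ᵥ ψ) -
      star ψ ⬝ᵥ ((numberOp y 0 + numberOp y 1) *ᵥ ψ) + star ψ ⬝ᵥ ψ := by
  have hP : gutzwillerProj *ᵥ ψ = ψ := (gutzwillerProj_mulVec_eq_self_iff ψ).2 hψ
  have h := congrArg (fun M => star ψ ⬝ᵥ (M *ᵥ ψ)) (SusyTJ.gutzwiller_bond_identity hxy)
  rw [expect_sandwich hP, expect_sandwich hP] at h
  rw [add_mulVec, dotProduct_add] at h
  rw [sub_mulVec, add_mulVec, add_mulVec, one_mulVec, dotProduct_sub, dotProduct_add, dotProduct_add,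
    singleOcc_mulVec hψ, singleOcc_mulVec hψ] at h
  rw [siteSwap, exchange, exchange]
  linear_combination (-1 : ℂ) * h

/-- **`P c†_{yσ} ψ = (1 - n_{yσ̄}) c†_{yσ} ψ` for Gutzwiller `ψ`**: creating an electron on a
Gutzwiller configuration leaves the Gutzwiller space exactly when the opposite spin is present.
[folklore] -/
theorem gutzwillerProj_creation_mulVec {ψ : Fock (Orb Λ)} (hψ : IsGutzwiller ψ) (y : Λ)
    {σ τ : Fin 2} (hστ : σ ≠ τ) :
    gutzwillerProj *ᵥ (creation (orb y σ) *ᵥ ψ) =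
      creation (orb y σ) *ᵥ ψ - numberOp y τ *ᵥ (creation (orb y σ) *ᵥ ψ) := by
  funext s
  rw [NagaokaTasaki.gutzwillerProj_mulVec_apply, Pi.sub_apply, LiebTwo.numberOp_mulVec,
    EtaPairingODLRO.creation_mulVec_apply]
  by_cases hy : orb y σ ∈ s
  · rw [if_pos hy]
    by_cases h0 : ψ (s.erase (orb y σ)) = 0
    · simp [h0]
    · have hG : ¬ HasDoubleOccupancy (s.erase (orb y σ)) := fun hd => h0 (hψ _ hd)
      by_cases hτ : orb y τ ∈ s
      · have hd : HasDoubleOccupancy s := NagaokaTasaki.hasDoubleOccupancy_of_ne hy hτ hστ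
        rw [if_pos hd, if_pos hτ, sub_self]
      · have hd : ¬ HasDoubleOccupancy s := by
          rintro ⟨z, hz0, hz1⟩
          by_cases hz : z = y
          · subst hz
            fin_cases σ <;> fin_cases τ
            · exact hστ rfl
            · exact hτ hz1
            · exact hτ hz0
            · exact hστ rfl
          · exact hG ⟨z, mem_erase.2 ⟨fun h => hz (orb_inj.1 h).1, hz0⟩,
              mem_erase.2 ⟨fun h => hz (orb_inj.1 h).1, hz1⟩⟩
        rw [if_neg hd, if_neg hτ, sub_zero]
  · rw [if_neg hy]
    split_ifs <;> simp

/-- The doublon part of `c†_{yσ} ψ` is orthogonal to the Gutzwiller space after any further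
Gutzwiller-diagonal processing: `P n_{yσ̄} c†_{yσ} = 0`. [folklore] -/
theorem gutzwillerProj_mul_number_mul_creation (y : Λ) {σ τ : Fin 2} (hστ : σ ≠ τ) :
    (gutzwillerProj : Matrix (Finset (Orb Λ)) (Finset (Orb Λ)) ℂ) *
        (numberOp y τ * creation (orb y σ)) = 0 := by
  have h1 : numberOp y τ * creation (orb y σ) =
      numberOp y τ * numberOp y σ * creation (orb y σ) := by
    rw [mul_assoc, numberOp, numberOp, number_mul_creation_self]
  have h2 : (gutzwillerProj : Matrix (Finset (Orb Λ)) (Finset (Orb Λ)) ℂ) *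
      (numberOp y τ * numberOp y σ) = 0 := by
    have h01 : ∀ ρ : Fin 2, ρ = 0 ∨ ρ = 1 := by decide
    rcases h01 σ with rfl | rfl <;> rcases h01 τ with rfl | rfl
    · exact absurd rfl hστ
    · rw [numberOp, numberOp, SusyTJ.number_mul_number_comm]
      exact SusyTJ.gutzwillerProj_mul_doublon y
    · exact SusyTJ.gutzwillerProj_mul_doublon y
    · exact absurd rfl hστ
  rw [h1, ← mul_assoc, h2, zero_mul]

end Projector

/-! ### Zero-momentum operators `C_σ = Σ_x c_{xσ}` and their anticommutator -/

section ZeroMomentum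

variable {Λ : Type*} [LinearOrder Λ] [Fintype Λ]

/-- `(Σ_x c†_{xσ})ᴴ = Σ_x c_{xσ}`. [folklore] -/
theorem conjTranspose_sum_creation (σ : Fin 2) :
    (∑ x : Λ, creation (orb x σ))ᴴ = ∑ x : Λ, annihilation (orb x σ) := by
  rw [conjTranspose_sum]
  exact Finset.sum_congr rfl fun x _ => creation_conjTranspose _

/-- `(Σ_x c_{xσ})ᴴ = Σ_x c†_{xσ}`. [folklore] -/
theorem conjTranspose_sum_annihilation (σ : Fin 2) :
    (∑ x : Λ, annihilation (orb x σ))ᴴ = ∑ x : Λ, creation (orb x σ) := by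
  rw [conjTranspose_sum]
  exact Finset.sum_congr rfl fun x _ => annihilation_conjTranspose _

/-- **`{C_σ, C_σ†} = |Λ|`** for the zero-momentum mode `C_σ = Σ_x c_{xσ}`. [folklore] -/
theorem zeroMomentum_anticomm (σ : Fin 2) :
    (∑ x : Λ, annihilation (orb x σ)) * (∑ x : Λ, creation (orb x σ)) +
        (∑ x : Λ, creation (orb x σ)) * (∑ x : Λ, annihilation (orb x σ)) =
      (Fintype.card Λ : ℂ) • (1 : Matrix (Finset (Orb Λ)) (Finset (Orb Λ)) ℂ) := by
  rw [Finset.sum_mul_sum, Finset.sum_mul_sum, Finset.sum_comm (f := fun x y => creation (orb x σ) * _),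
    ← Finset.sum_add_distrib]
  simp_rw [← Finset.sum_add_distrib]
  have h : ∀ x y : Λ, annihilation (orb x σ) * creation (orb y σ) +
      creation (orb y σ) * annihilation (orb x σ) =
      if x = y then (1 : Matrix (Finset (Orb Λ)) (Finset (Orb Λ)) ℂ) else 0 := by
    intro x y
    rw [annihilation_mul_creation_add_creation_mul_annihilation_holds]
    by_cases hxy : x = y
    · rw [if_pos hxy, if_pos (by rw [hxy])]
    · rw [if_neg hxy, if_neg (fun h => hxy (orb_inj.1 h).1)]
  simp_rw [h]
  simp only [Finset.sum_ite_eq, Finset.mem_univ, if_true, Finset.sum_const, Finset.card_univ]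
  rw [← Nat.cast_smul_eq_nsmul ℂ]

/-- `‖C_σ ψ‖² + ‖C_σ† ψ‖² = |Λ| ‖ψ‖²`. [folklore] -/
theorem zeroMomentum_norm_add (σ : Fin 2) (ψ : Fock (Orb Λ)) :
    star ((∑ x : Λ, annihilation (orb x σ)) *ᵥ ψ) ⬝ᵥ ((∑ x : Λ, annihilation (orb x σ)) *ᵥ ψ) +
      star ((∑ x : Λ, creation (orb x σ)) *ᵥ ψ) ⬝ᵥ ((∑ x : Λ, creation (orb x σ)) *ᵥ ψ) =
      (Fintype.card Λ : ℂ) * (star ψ ⬝ᵥ ψ) := by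
  rw [star_mulVec_dotProduct_mulVec, star_mulVec_dotProduct_mulVec, conjTranspose_sum_annihilation,
    conjTranspose_sum_creation, ← dotProduct_add, ← add_mulVec, add_comm, zeroMomentum_anticomm,
    smul_mulVec, one_mulVec, dotProduct_smul, smul_eq_mul]

/-- `⟨ψ, C_σ† C_σ ψ⟩ = Σ_x Σ_y ⟨ψ, c†_{xσ} c_{yσ} ψ⟩`. [folklore] -/
theorem zeroMomentum_normSq_eq_sum (σ : Fin 2) (ψ : Fock (Orb Λ)) :
    star ((∑ x : Λ, annihilation (orb x σ)) *ᵥ ψ) ⬝ᵥ ((∑ x : Λ, annihilation (orb x σ)) *ᵥ ψ) =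
      ∑ x : Λ, ∑ y : Λ, star ψ ⬝ᵥ ((creation (orb x σ) * annihilation (orb y σ)) *ᵥ ψ) := by
  rw [star_mulVec_dotProduct_mulVec, conjTranspose_sum_annihilation, Finset.sum_mul_sum, sum_mulVec,
    dotProduct_sum]
  refine Finset.sum_congr rfl fun x _ => ?_
  rw [sum_mulVec, dotProduct_sum]

end ZeroMomentum

/-! ### Spin flips -/

section SpinFlip

variable {Λ : Type*} [LinearOrder Λ] [Fintype Λ]

/-- Reordering of the mixed term of `B†B`: `(c†_{y↑}c_{x↑})(c†_{x↓}c_{y↓}) = -(c†_{x↓}c_{x↑})(c†_{y↑}c_{y↓})`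
(`= -S⁻_x S⁺_y`) for `x ≠ y`. [folklore] -/
theorem flipTerm_eq_neg {x y : Λ} (hxy : x ≠ y) :
    creation (orb y 0) * annihilation (orb x 0) * (creation (orb x 1) * annihilation (orb y 1)) =
      -(creation (orb x 1) * annihilation (orb x 0) * (creation (orb y 0) * annihilation (orb y 1))) := by
  set A := creation (orb y 0)
  set a := annihilation (orb x 0)
  set B := creation (orb x 1)
  set b := annihilation (orb y 1)
  have h1 : a * B = -(B * a) :=
    SusyTJ.annihilation_mul_creation_of_ne (EtaPairingODLRO.orb_zero_ne_orb_one x)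
  have h2 : A * B = -(B * A) := creation_mul_creation_eq_neg _ _
  have h3 : a * A = -(A * a) :=
    SusyTJ.annihilation_mul_creation_of_ne (EtaPairingODLRO.orb_ne_orb_of_ne hxy 0 0)
  calc A * a * (B * b) = A * (a * B) * b := by noncomm_ring
    _ = -(A * B) * a * b := by rw [h1]; noncomm_ring
    _ = B * A * a * b := by rw [h2]; noncomm_ring
    _ = -(B * (a * A) * b) := by rw [h3]; noncomm_ring
    _ = -(B * a * (A * b)) := by noncomm_ring

/-- The same-site flip product `S⁻_x S⁺_x = n_{x↓} - n_{x↑} n_{x↓}`. [folklore] -/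
theorem flipTerm_same (x : Λ) :
    creation (orb x 1) * annihilation (orb x 0) * (creation (orb x 0) * annihilation (orb x 1)) =
      numberOp x 1 - numberOp x 0 * numberOp x 1 := by
  have h01 : orb x 0 ≠ orb x 1 := EtaPairingODLRO.orb_zero_ne_orb_one x
  have hn : creation (orb x 1) * (creation (orb x 0) * annihilation (orb x 0)) =
      creation (orb x 0) * annihilation (orb x 0) * creation (orb x 1) :=
    (number_mul_creation_of_ne h01).symm
  simp only [numberOp]
  calc creation (orb x 1) * annihilation (orb x 0) * (creation (orb x 0) * annihilation (orb x 1))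
      = creation (orb x 1) * (annihilation (orb x 0) * creation (orb x 0)) * annihilation (orb x 1) := by
        noncomm_ring
    _ = creation (orb x 1) * (1 - creation (orb x 0) * annihilation (orb x 0)) *
          annihilation (orb x 1) := by
        rw [annihilation_mul_creation, if_pos rfl]
    _ = creation (orb x 1) * annihilation (orb x 1) -
          creation (orb x 1) * (creation (orb x 0) * annihilation (orb x 0)) * annihilation (orb x 1) := by
        noncomm_ring
    _ = creation (orb x 1) * annihilation (orb x 1) -
          creation (orb x 0) * annihilation (orb x 0) * (creation (orb x 1) * annihilation (orb x 1)) := by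
        rw [hn, mul_assoc]

/-- `‖S⁺ψ‖² = Σ_x Σ_y ⟨ψ, (c†_{x↓}c_{x↑})(c†_{y↑}c_{y↓}) ψ⟩`. [folklore] -/
theorem spinPlus_normSq_eq_sum (ψ : Fock (Orb Λ)) :
    star (spinPlus *ᵥ ψ) ⬝ᵥ (spinPlus *ᵥ ψ) =
      ∑ x : Λ, ∑ y : Λ, star ψ ⬝ᵥ
        ((creation (orb x 1) * annihilation (orb x 0) * (creation (orb y 0) * annihilation (orb y 1))) *ᵥ ψ) := by
  rw [star_mulVec_dotProduct_mulVec, NagaokaTasaki.conjTranspose_spinPlus, spinPlus, Finset.sum_mul_sum,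
    sum_mulVec, dotProduct_sum]
  refine Finset.sum_congr rfl fun x _ => ?_
  rw [sum_mulVec, dotProduct_sum]

end SpinFlip

end Summit.HubbardSuperconductivity.HubbardSuperconductivity.Theorems.HyperoctahedralMott.Anchor
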